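import Literature.MathematicalPhysics.QuantumFieldTheory.Balaban1983to89.Node00.TorusCoverLandau153RecDatumDoorGradPrecompExplicit
import Literature.MathematicalPhysics.QuantumFieldTheory.Balaban1983to89.Node00.TorusCoverLandau153RecordDentCubeDomains
import Literature.MathematicalPhysics.QuantumFieldTheory.Balaban1983to89.Node00.TorusCoverCubeRecordDentSaturation
import Literature.MathematicalPhysics.QuantumFieldTheory.Balaban1983to89.Node00.DomainsOfSeq
import Summits.QuantumFields.YangMills.Theorems.BalabanUVNodesN07DatumCrownPhiOfRecordCrownPrecomp
import Summits.QuantumFields.YangMills.Theorems.BalabanUVNodesN07Thm4RecMember152OfCrown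
import HarnessLib

/-!
# N07 [B11] (= [15] = [Balaban1985Variational]) Sect. F — MODULE 129 (W2): **ROWS 1–8 + (T2b) OF THE DEF OF RECORD (β′) `HThm4RecSym152PhiEG` AT THE DENTED DATUM, FROM THE
# PRE-COMPOSED CROWN `DatumCrownPhiAt`** — the knit ✓p745548 `hThm4RecMember152_of_datumCrownAt` re-run at `recordCubePZ … ((domainsOfSeq s.Ω j hk).Om j)` ([15] (150) «Ω′_k = □_k ∩ Ω_k»)
# over the junction's PRECOMP doors (dag-n07-w3 INTENT-24∕25) and this lane's dented (153) bridge (MODULE 128 ✓p757399)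

Cell `pub-ymgap`, seat `pub-ymgap-dag-n07-e` g32 (FAN-OUT §N07 row s3; LANE OWNER of the K0 road chart side; (W2) handed over by dag-n07-w3 g13, cell bus 2026-08-30 02:20Z).
`--kind proof --supports stmt-QuantumFields-20541 --as helper` (K0⁷; count-neutral).  ONE theorem (+ two small lemmas), 0 `def`.  [15] = [Balaban1985Variational]; [6] =
[Balaban1985RegularSpaces]; [II] = [Balaban1984PropagatorsII]; [III] = [Balaban1988Convergent]; [I] = [Balaban1987RG1].

WHY.  Row 9′ of the def of record is read at the cells of the meet `D″ = cubeDomains ⊓ domainsOfSeq s.Ω j` (⚑ LOCATED-TOP-DENT), so the crown runs at the DENTED print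
datum, pre-composed by the junction's block-constant `h` (✓p751907 `DatumCrownPhiAt`); rows 1–8 + (T2b) for the door's torus gauge `(u, A)` then follow as in ✓p745548 with
three located differences: (a) the doors are the EXPLICIT-`u` PRECOMP twins (MODULES 130∕131, token twins of dag-n07-w3's ✓p757755∕p758087; the pass-throughs `Restr129Z … u` ∕ (137), false resp. mis-shaped at `h⁻¹·u₀`, dropped);
(b) row 8 ((153)) is read at the meet's own cells by MODULE 128, its region row discharged from «`π(□̃) ⊆ Ω_{j−1}`» + nesting (`mem_domainsOfSeq_Om_iff`); (c) the letters at
the DENTED top are read one level down (`□_jᶻ ⊆ □_{j−1}ᶻ = c_d.sq (j−1)`), the extra factor `L` absorbed by the strict budget (`t ≤ L⁴`).  `InAk` for the dented family is the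
constant family's (✓`inAk_coverLiftShift_tcubeZ_of_top`) by antitonicity (`B8Ineq132.condAt_anti`); the dent premise is ✓p753327 from the (c-ii)‴ datum row.

WHAT IS PROVED (sorry-free; axioms standard).
§1 `inAk_dentFamZ_of_tcubeZ` (antitone), `mem_domainsOfSeq_Om_of_cover_tcube_subset` (the collar ⇒ «label covers a site of `Ω_{j′}^{(j′)}`»).
§2 ★★★ `rows152_of_datumCrownPhiAt` — per datum of the def of record (binders of `HThm4RecSym152PhiEG F N Mc ρ (F.L^{s+1}) κ a₀ Ψ` up to `hmeet`, the grid row at `Md := L^{s+1}`) and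
   per junction choice `(h, hSU, hh1, X, hconst, ω, hω0, hω1, hoscj, hosc0)` with the per-datum numerics `hbud ∕ h4` at radius `r := Cr·(L³ε_{j−1}) + Cω·ω`: `∃ u₀` (the crown's output:
   SU-valued, `= 1` off `□₀ᶻ`, (1.29)-normalised on the dented cells, `vfix`∕`AgreeOn` rows) `∃ (u, A)`, the door formula `ι(u(π(x + c_j))) = ((h⁻¹u₀) x)⁻¹·vfix x` on `□₀ᶻ` ∧ rows
   1–8 + (T2b) of `HThm4RecSym152PhiEG` for `(u, A)`.
HONEST FRAMING: count-neutral composition; `DatumCrownPhiAt` is a DISPLAYED premise; row 9′ is NOT produced here (the junction's knit); nothing of [15]∕[6]∕[II]∕[I]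
asserted beyond the cited modules; `HThm4RecSym152PhiEG` ∕ `HThm4Rec*` UNDISCHARGED; N05 ∕ N07 NOT discharged; K0⁷ ∕ K1⁹ NOT closed; counts unmoved; R4 closes the conditional
finite-𝕋⁴ rung `BalabanLadder.UV` ONLY; the YM mass gap (Clay) is NOT proved; nothing continuum ∕ ℝ⁴ ∕ OS.  No `def`, no `instance`, no `notation`, no `sorry`.

References: [15] (144) p. 300, (147)–(153) p. 301; [6] Thm. 4 p. 88, Prop. 6 (1.130)–(1.138) pp. 98–99, (1.7)–(1.9) p. 77, (1.29) p. 81; [II] (2.10)–(2.12) p. 225; [III] (2.1)–(2.2)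
p. 254; [I] (0.1) p. 251, (0.3)–(0.4) pp. 252–253.
-/

set_option autoImplicit false

noncomputable section

open scoped BigOperators Matrix.Norms.L2Operator

namespace Summit.QuantumFields.YangMills.BalabanUVNodes.N07Thm4Rows152OfDatumCrownPhiAt

open Literature.MathematicalPhysics.QuantumFieldTheory.Balaban1983to89
open Literature.MathematicalPhysics.QuantumFieldTheory.Balaban1983to89.Node00
open Literature.MathematicalPhysics.QuantumFieldTheory.Balaban1983to89.B12RegularSpaces111 (gaugeU expI grad)
open Literature.MathematicalPhysics.QuantumLattice (blockSites)
open B15Eq112TorusCover (cover)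
open B14DomainGeom (Pt Within)
open B8Eq131Cubes (box cube tcube)
open B8Eq131CubesRec (cubeZ tcubeZ)
open B6SectAOperatorsV1 (RE dsE)
open B7Prop1Explicit (e)
open B7Prop1Local (InBox)
open B7Prop2SpecialUnitary (specialUnitaryUnits)
open BlockAveragingZd (ctrShift)
open B8Ineq132 (InAk condAt_anti)
open B8Eq140Level (SideTouches)
open B8Eq138LandauZd (logCfg)
open B8Eq119TwistedAxialRec (Restr129Z UnderZ)
open B7AvgGaugeCovariance (uLev)
open Literature.MathematicalPhysics.QuantumFieldTheory.BalabanImbrieJaffe1984to88.BIJ85AxialPropagator411 (BondSpace)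
open T4Continuum (T4Family)
open N07Thm4RecMemberOfCrown (sitesPerDir_anti pow_mul_eta_inv_eq)
open N07DatumCrownPhiOfRecordCrownPrecomp (DatumCrownPhiAt)
open N07SplitClauseBoxesCubeDomains (exists_lift_of_iterBlockOf_eq)

variable (F : T4Family) (N : ℕ) [NeZero N]

/-! ## §1  Two bookkeeping lemmas: `InAk` is antitone in the family; the collar gives the region row of MODULE 128 -/

variable {F N} in
/-- `𝔄_j({Ω′}, α)` is ANTITONE in the family: the dented family `dentFamZ` lies inside the constant family `□̃ᶻ` levelwise, so the constant family's `InAk` gives the dented one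
(`B8Ineq132.condAt_anti`: fewer plaquettes ∕ bonds to check). [cite: Balaban1985RegularSpaces, (1.7)–(1.9) p.77; Balaban1985Variational, (148)–(150) p.301] -/
theorem inAk_dentFamZ_of_tcubeZ {P : Params} {𝔸 : Type*} [NormedRing 𝔸] [NormOneClass 𝔸] [NormedAlgebra ℂ 𝔸] [CompleteSpace 𝔸]
    {n M ρ : ℕ} {a : Pt P.d} {Dtop : Finset (Site P n)} {η α : ℝ} {V : B7Prop1Explicit.Site P.d → Fin P.d → 𝔸ˣ}
    (h : InAk P.L n η α (fun _ => tcubeZ P.L (cornerP P M ρ a) (sideP P M ρ) ρ n) V) : InAk P.L n η α (dentFamZ P n M ρ a Dtop) V := by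
  intro j hj
  refine condAt_anti ?_ (h j hj)
  by_cases hjn : j = n
  · subst hjn; rw [dentFamZ_top]; exact Set.inter_subset_left
  · rw [dentFamZ_of_ne hjn]

/-- **THE COLLAR GIVES MODULE 128's REGION ROW**: if `π(□̃) ⊆ Ω_{j−1}` (fine sites; [15] (144)) and the run's regions decrease, then for `1 ≤ j′ < j` every level-`j′` label `s` of
`□_{j′}^{(j′)}` (engine coordinates) covers a site of `Ω_{j′}^{(j′)}` of `domainsOfSeq s.Ω j hk` — every fine site of its block lies in `□_{j′} ⊆ □̃`, hence in `Ω_{j−1} ⊆ Ω_i`, `i ≤ j′`.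
[cite: Balaban1985Variational, (144) p.300, (148) p.301; Balaban1988Convergent, (2.1)–(2.2) p.254; Balaban1987RG1, (0.1) p.251] -/
theorem mem_domainsOfSeq_Om_of_cover_tcube_subset (K : ℕ) (Ω : ℕ → Set (Site (F.P K) 0)) {j : ℕ} (hk : j ≤ (F.P K).m + (F.P K).K)
    (hnest : ∀ i : ℕ, 1 ≤ i → i + 1 ≤ j - 1 → Ω (i + 1) ⊆ Ω i)
    {a : Pt (F.P K).d} {M ρ : ℕ} (hρ : 1 ≤ ρ) (hcollar : cover (F.P K) '' tcube (F.P K).L a M ρ j ⊆ Ω (j - 1))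
    {j' : ℕ} (hj'1 : 1 ≤ j') (hj' : j' < j) {s : Pt (F.P K).d}
    (hs : InBox (B8Eq131Cubes.sqLo (F.P K).L a ρ j j') (B8Eq131Cubes.sqHi (F.P K).L a M ρ j j') s) :
    coverAt (F.P K) j' s ∈ (domainsOfSeq Ω j hk).Om j' := by
  rw [mem_domainsOfSeq_Om_iff Ω hk hj'.le]
  intro x hx i hi1 hij'
  -- lift `x` to the block of `s`
  obtain ⟨X, hX, hXx⟩ := exists_lift_of_iterBlockOf_eq (hj'.le.trans hk) hx
  have hXcube : X ∈ cube (F.P K).L a M ρ j j' := by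
    haveI : NeZero ((F.P K).L ^ j') := ⟨(pow_pos (F.P K).L_pos j').ne'⟩
    have hmem : X ∈ blockSites ((F.P K).L ^ j') s := (Literature.MathematicalPhysics.QuantumLattice.mem_blockSites_iff _ _ _).2 hX
    exact blockSites_subset_cube_of_inBox hs hmem
  have hXt : X ∈ tcube (F.P K).L a M ρ j := B8Eq131Cubes.cube_subset_tcube (F.P K).hL.2 hρ hj'.le hXcube
  have hxΩ : x ∈ Ω (j - 1) := by rw [← hXx]; exact hcollar ⟨X, hXt, rfl⟩
  -- descend `Ω_{j−1} ⊆ Ω_i`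
  have key : ∀ n : ℕ, i + n ≤ j - 1 → x ∈ Ω (i + n) → x ∈ Ω i := by
    intro n
    induction n with
    | zero => intro _ h; simpa using h
    | succ n ih =>
      intro hn h
      exact ih (by omega) (hnest (i + n) (by omega) (by omega) (by simpa [Nat.add_assoc] using h))
  exact key (j - 1 - i) (by omega) (by rw [Nat.add_sub_cancel' (by omega : i ≤ j - 1)]; exact hxΩ)


/-! ## §2  The knit at the dented datum -/

set_option maxHeartbeats 800000 in
/-- ★★★ **ROWS 1–8 + (T2b) OF `HThm4RecSym152PhiEG` AT THE DENTED DATUM, FROM THE PRE-COMPOSED CROWN** — ✓p745548 §3 re-run at `c_d := recordCubePZ … ((domainsOfSeq s.Ω j hk).Om j)`: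
per datum of the def of record (its binders up to `hmeet`, with the grid row of (c-ii)‴ at modulus `L^{s+1}`) and per junction choice `(h, X, ω)` with their displayed rows (exactly
`DatumCrownPhiAt`'s ∀-binders, plus `hh1 : h = 1` off `□₀ᶻ`), and with the per-datum numerics `hbud` (strict budget up to `t ≤ L⁴`) and `h4` at the radius `r := Cr·(L³ε_{j−1}) + Cω·ω`:
the collar inclusion `π(□̃) ⊆ Ω_{j−1}` (re-exported), the crown's output `u₀` (re-exported: SU-valued, `= 1` off `□₀ᶻ`, (1.29)-normalised on the DENTED cells) and the door's torus gauge `(u, A)` with the door formula on `□₀ᶻ` and rows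
1–8 + (T2b) — row 8 ((153)) at the MEET's own cells (MODULE 128), the top-level letters read one level down.  Row 9′ is NOT produced (the junction's knit, from the same `u₀`, `h`).
[cite: Balaban1985Variational, (144) p.300, (147)–(153) p.301, (152) p.301; Balaban1985RegularSpaces, Thm. 4 p.88, Prop. 6 (1.130)–(1.138) p.99, (1.7)–(1.9) p.77, (1.29) p.81; Balaban1984PropagatorsII, (2.10)–(2.12) p.225; Balaban1988Convergent, (2.1)–(2.2) p.254; Balaban1987RG1, (0.1) p.251, (0.3)–(0.4) pp.252–253] -/
theorem rows152_of_datumCrownPhiAt {Mc ρ : ℕ} (hρ : F.L ≤ ρ) {s : ℕ} {Cr Cω α₁ ω₁ κ a₀ : ℝ} (hCr : 0 ≤ Cr) (hCω : 0 ≤ Cω)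
    (hcrown : DatumCrownPhiAt F N Mc ρ hρ s Cr Cω α₁ ω₁) (hsρ : F.L ^ (s + 1) ∣ ρ) (hα : (F.L : ℝ) ^ 3 * a₀ ≤ α₁)
    -- the datum (binders of the def of record up to `hmeet`, with the (c-ii)‴ grid row at modulus `L^{s+1}`; its idle binders `hk1`, `hcomp` omitted)
    (ν : Stage7Numerics) (M : ℕ) (g : ℕ → ℝ) (K k : ℕ) (sq : SeqOfRecord F ν M g K k) (hsep : Sect2.SeqSeparated ν.M₁ sq) (hM₁ : 0 < ν.M₁)
    (hfl : (11 * 4 + 4 * ρ + Mc + 3) * F.L ≤ ν.M₁) (hnw : Mc + 11 * 4 + 6 * ρ ≤ (F.P K).sitesPerDir k)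
    (hgrid : ∀ i : ℕ, 1 ≤ i → i ≤ k →
      F.L ^ (s + 1) ∣ M * RkOfRecord (F.P K).L ν.r (g i) ∧ dCubeSide (F.P K).L M (RkOfRecord (F.P K).L ν.r (g i)) i ∣ (F.P K).sitesPerDir 0)
    (ε : ℕ → ℝ) (hε : ∀ n, n ≤ k → 0 < ε n ∧ ε n ≤ a₀)
    (U : GaugeField (F.P K) 0 (SU N))
    (hP : ∀ n, n ≤ k → PlaqSmallOn (Sect2.omegaPlaqsTop sq.Ω (suppDomOfRecord F ν K sq.Ω) n) (ε n * (F.P K).eta n ^ 2) U)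
    (hD : ∀ n, n ≤ k → Sect2.CoDivSmallOn (Sect2.omegaBondsTop sq.Ω (suppDomOfRecord F ν K sq.Ω) n) (ε n * (F.P K).eta n ^ 3) U)
    (j : ℕ) (hk : j ≤ (F.P K).m + (F.P K).K) (hj1 : 1 ≤ j) (hjk : j ≤ k) (idx : Pt (F.P K).d)
    (hmeet : ∃ x ∈ box (F.P K).L (cornerP (F.P K) Mc ρ idx) (sideP (F.P K) Mc ρ) j, ∃ y : Pt (F.P K).d, cover (F.P K) y ∈ sq.Ω j ∧ Within ((3 : ℕ) : ℤ) x y)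
    -- the junction's choice: pre-composition `h` (SU-valued, `= 1` off `□₀ᶻ`, block-constant under the dented cells), oscillation letter `ω`
    (h : B7Prop1Explicit.Site (F.P K).d → (MatA N)ˣ) (hSU : ∀ x, h x ∈ specialUnitaryUnits (Fin N))
    (hh1 : ∀ x, x ∉ (recordCubePZ (F.P K) j hj1 hk Mc ρ hρ idx ((domainsOfSeq sq.Ω j hk).Om j)).sq 0 → h x = 1)
    (X : ℕ → B7Prop1Explicit.Site (F.P K).d → (MatA N)ˣ)
    (hconst : ∀ j', 1 ≤ j' → j' ≤ j → ∀ y ∈ (recordCubePZ (F.P K) j hj1 hk Mc ρ hρ idx ((domainsOfSeq sq.Ω j hk).Om j)).lamS j', ∀ x, UnderZ (F.P K).L j' y x → h x = X j' y)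
    (ω : ℝ) (hω0 : 0 ≤ ω) (hω1 : ω ≤ ω₁)
    (hoscj : ∀ j', j' ≤ j → ∀ (z : B7Prop1Explicit.Site (F.P K).d) (μ : Fin (F.P K).d),
      (∀ x, InBox (fun i => ((F.P K).L : ℤ) ^ j' * z i - (ctrShift (F.P K).L j' : ℤ))
          (fun i => ((F.P K).L : ℤ) ^ j' * z i + (ctrShift (F.P K).L j' : ℤ) + if i = μ then ((F.P K).L : ℤ) ^ j' else 0) x →
        x ∈ (recordCubePZ (F.P K) j hj1 hk Mc ρ hρ idx ((domainsOfSeq sq.Ω j hk).Om j)).sq (j' - 1)) →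
      ‖((uLev (F.P K).L h j' z : (MatA N)ˣ) : MatA N) - ((uLev (F.P K).L h j' (z + e μ) : (MatA N)ˣ) : MatA N)‖ ≤ ω)
    (hosc0 : ∀ b ∈ {b : B7Prop1Explicit.Site (F.P K).d × Fin (F.P K).d | SideTouches ((recordCubePZ (F.P K) j hj1 hk Mc ρ hρ idx ((domainsOfSeq sq.Ω j hk).Om j)).sq 0) b.1 b.2},
      ‖((h b.1 : (MatA N)ˣ) : MatA N) - ((h (b.1 + e b.2) : (MatA N)ˣ) : MatA N)‖ ≤ ω)
    -- per-datum numerics at the radius `r := Cr·(L³·ε_{j−1}) + Cω·ω`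
    (hbud : ∀ t : ℝ, 0 ≤ t → t ≤ (F.L : ℝ) ^ 4 → 2 * ((Cr * ((F.L : ℝ) ^ 3 * ε (j - 1)) + Cω * ω) * t) < κ * ε j)
    (h4 : 4 * ((N : ℝ) * (Cr * ((F.L : ℝ) ^ 3 * ε (j - 1)) + Cω * ω)) < 2 * Real.pi) :
    letI : CStarAlgebra (MatA N) := {};
    -- the collar inclusion `π(□̃) ⊆ Ω_{j−1}` ([15] (144)), re-exported for the junction's row 9′
    cover (F.P K) '' tcube (F.P K).L (cornerP (F.P K) Mc ρ idx) (sideP (F.P K) Mc ρ) ρ j ⊆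
        (if j - 1 = 0 then suppDomOfRecord F ν K sq.Ω else sq.Ω (j - 1)) ∧
    ∃ u₀ : B7Prop1Explicit.Site (F.P K).d → (MatA N)ˣ, (∀ x, u₀ x ∈ specialUnitaryUnits (Fin N)) ∧ (∀ x, x ∉ (recordCubePZ (F.P K) j hj1 hk Mc ρ hρ idx ((domainsOfSeq sq.Ω j hk).Om j)).sq 0 → u₀ x = 1) ∧
      Restr129Z (F.P K).L j (recordCubePZ (F.P K) j hj1 hk Mc ρ hρ idx ((domainsOfSeq sq.Ω j hk).Om j)).lamS (1 : B7Prop1Explicit.Site (F.P K).d → Fin (F.P K).d → (MatA N)ˣ) u₀ ∧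
    ∃ (u : GaugeTransf (F.P K) 0 (SU N)) (A : PBond (F.P K) 0 → MatA N),
      -- the door formula on `□₀ᶻ`
      (∀ x, x ∈ (recordCubePZ (F.P K) j hj1 hk Mc ρ hρ idx ((domainsOfSeq sq.Ω j hk).Om j)).sq 0 → ιSU N (u (cover (F.P K) (x + fun _ => (ctrShift (F.P K).L j : ℤ)))) = ((h⁻¹ * u₀) x)⁻¹ * (recordCubePZ (F.P K) j hj1 hk Mc ρ hρ idx ((domainsOfSeq sq.Ω j hk).Om j)).vfix (fun x μ => ιSU N (U ⟨cover (F.P K) (x + fun _ => (ctrShift (F.P K).L j : ℤ)), μ⟩)) x) ∧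
      -- rows 1–8 + (T2b) of `HThm4RecSym152PhiEG` for `(u, A)`
      (∀ b ∈ (Sect2.regionOfSet (F.P K) (cover (F.P K) '' box (F.P K).L (cornerP (F.P K) Mc ρ idx) (sideP (F.P K) Mc ρ) j)).bonds,
        gaugeU (fun x => ιSU N (u x)) (fun b' => ιSU N (U b')) b = expI ((F.P K).eta j) (A b)) ∧
      (∀ b ∈ (Sect2.regionOfSet (F.P K) (cover (F.P K) '' cube (F.P K).L (cornerP (F.P K) Mc ρ idx) (sideP (F.P K) Mc ρ) ρ j 0)).bonds,
        gaugeU (fun x => ιSU N (u x)) (fun b' => ιSU N (U b')) b = expI ((F.P K).eta j) (A b)) ∧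
      (∀ j', j' ≤ j →
        ∀ b ∈ (Sect2.regionOfSet (F.P K) (cover (F.P K) '' cube (F.P K).L (cornerP (F.P K) Mc ρ idx) (sideP (F.P K) Mc ρ) ρ j j')).bonds,
          ‖A b‖ < κ * ε j * ((F.P K).L : ℝ) ^ (j - j')) ∧
      (∀ j', j' ≤ j →
        ∀ q ∈ (Sect2.regionOfSet (F.P K) (cover (F.P K) '' cube (F.P K).L (cornerP (F.P K) Mc ρ idx) (sideP (F.P K) Mc ρ) ρ j j')).dpairs,
          ‖grad ((F.P K).eta j) q.2.1 (fun y => A ⟨y, q.2.2⟩) q.1‖ < κ * ε j * ((F.P K).L : ℝ) ^ (2 * (j - j'))) ∧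
      (∀ b ∈ (Sect2.regionOfSet (F.P K) (cover (F.P K) '' box (F.P K).L (cornerP (F.P K) Mc ρ idx) (sideP (F.P K) Mc ρ) j)).bonds,
        ‖A b‖ < κ * ε j) ∧
      (∀ q ∈ (Sect2.regionOfSet (F.P K) (cover (F.P K) '' box (F.P K).L (cornerP (F.P K) Mc ρ idx) (sideP (F.P K) Mc ρ) j)).dpairs,
        ‖grad ((F.P K).eta j) q.2.1 (fun y => A ⟨y, q.2.2⟩) q.1‖ < κ * ε j) ∧
      (∀ b ∈ Sect2.bondsDeep (cover (F.P K) '' box (F.P K).L (cornerP (F.P K) Mc ρ idx) (sideP (F.P K) Mc ρ) j),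
        ‖Sect2.codiffCurlA ((F.P K).eta j) A b.src b.dir‖ < κ * ε j) ∧
      (∀ b ∈ Sect2.bondsDeep (cover (F.P K) '' box (F.P K).L (cornerP (F.P K) Mc ρ idx) (sideP (F.P K) Mc ρ) j),
        ‖∑ ν' : Fin (F.P K).d, (((F.P K).eta j : ℝ) : ℂ)⁻¹ •
            (grad ((F.P K).eta j) ν' (fun y => A ⟨y, b.dir⟩) (b.src.unshift ν') - grad ((F.P K).eta j) ν' (fun y => A ⟨y, b.dir⟩) b.src)‖ < κ * ε j) ∧
      (∀ φ : MatA N →L[ℂ] ℂ,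
        RE (domainsMeet (cubeDomains (F.P K) (cornerP (F.P K) Mc ρ idx) (sideP (F.P K) Mc ρ) ρ j hk) (domainsOfSeq sq.Ω j hk)) ((F.P K).eta j)⁻¹
            (dsE ((F.P K).eta j)⁻¹ (WithLp.toLp 2 fun b => (φ (A b)).re : BondSpace (F.P K))) = 0 ∧
        RE (domainsMeet (cubeDomains (F.P K) (cornerP (F.P K) Mc ρ idx) (sideP (F.P K) Mc ρ) ρ j hk) (domainsOfSeq sq.Ω j hk)) ((F.P K).eta j)⁻¹
            (dsE ((F.P K).eta j)⁻¹ (WithLp.toLp 2 fun b => (φ (A b)).im : BondSpace (F.P K))) = 0) := by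
  letI : CStarAlgebra (MatA N) := {}
  -- ### letters and tolerances (as in ✓p745548)
  have hL2 : 2 ≤ F.L := (F.P 0).hL.2
  have hL1 : (1 : ℝ) ≤ F.L := by exact_mod_cast (F.P 0).L_pos
  have hd : 2 ≤ (F.P K).d := by rw [T4Family.P_d]; norm_num
  have hρ' : (F.P K).L ≤ ρ := by rw [T4Family.P_L]; exact hρ
  have hρ1 : 1 ≤ ρ := le_trans (le_trans (by norm_num) (F.P K).hL.2) hρ'
  have hεj1 : 0 < ε (j - 1) := (hε (j - 1) (by omega)).1
  have hεj1a : ε (j - 1) ≤ a₀ := (hε (j - 1) (by omega)).2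
  have hεj : 0 < ε j := (hε j hjk).1
  have hL3 : (0 : ℝ) < (F.L : ℝ) ^ 3 := by positivity
  have hαpos : 0 < ((F.P K).L : ℝ) ^ 3 * ε (j - 1) := by rw [T4Family.P_L]; exact mul_pos hL3 hεj1
  have hαle : ((F.P K).L : ℝ) ^ 3 * ε (j - 1) ≤ α₁ := by
    rw [T4Family.P_L]; exact (mul_le_mul_of_nonneg_left hεj1a hL3.le).trans hα
  set r : ℝ := Cr * (((F.P K).L : ℝ) ^ 3 * ε (j - 1)) + Cω * ω with hrdef
  have hr : 0 ≤ r := by positivity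
  have hrF : r = Cr * ((F.L : ℝ) ^ 3 * ε (j - 1)) + Cω * ω := by rw [hrdef, T4Family.P_L]
  have h4' : 4 * ((N : ℝ) * r) < 2 * Real.pi := by rw [hrF]; exact h4
  -- ### (c) the non-wrapping of `□̃` from the guard
  have hg : Mc + 11 * (F.P K).d + 6 * ρ ≤ (F.P K).sitesPerDir j := by
    rw [T4Family.P_d]; exact hnw.trans (sitesPerDir_anti (F.P K) hjk)
  have hinj := injOn_cover_tcube_of_guard (P := F.P K) (a := idx) hk hg
  have hinj0 : Set.InjOn (cover (F.P K)) (cube (F.P K).L (cornerP (F.P K) Mc ρ idx) (sideP (F.P K) Mc ρ) ρ j 0) :=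
    hinj.mono (B8Eq131Cubes.cube_subset_tcube (F.P K).hL.2 hρ1 (Nat.zero_le _))
  -- ### (b) the collar inclusion from the meeting witness (as in ✓p745548)
  obtain ⟨x, hx, y, hy, hxy⟩ := hmeet
  have hcollar : cover (F.P K) '' tcube (F.P K).L (cornerP (F.P K) Mc ρ idx) (sideP (F.P K) Mc ρ) ρ j ⊆
      (if j - 1 = 0 then suppDomOfRecord F ν K sq.Ω else sq.Ω (j - 1)) := by
    rcases Nat.lt_or_ge j 2 with hj2 | hj2
    · have hj1' : j = 1 := by omega
      subst hj1'
      rw [if_pos rfl, suppDomOfRecord_eq]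
      rintro _ ⟨z, hz, rfl⟩
      have hz' : z ∈ (cubeIdxP' (F.P K) 1 le_rfl Mc ρ idx).Ω 0 := by rw [cubeIdxP'_Ω]; exact hz
      have hw := within_of_mem_Ω_cubeIdxP'_of_within_box (P := F.P K) le_rfl hx hxy hz'
      refine cover_mem_hullD_one_of_within hM₁ hy (hw.mono ?_)
      rw [B14.Eq213MaximalDomains.side, pow_one, T4Family.P_d, T4Family.P_L]
      have hf : (((11 * 4 + 4 * ρ + Mc + 3) * F.L : ℕ) : ℤ) ≤ ν.M₁ := by exact_mod_cast hfl
      have hL1z : (1 : ℤ) ≤ F.L := by exact_mod_cast (F.P 0).L_pos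
      push_cast at hf ⊢
      nlinarith
    · rw [if_neg (by omega)]
      have hfloor : 11 * (F.P K).d + 4 * ρ + Mc + 3 ≤ ν.M₁ := by
        rw [T4Family.P_d]
        exact le_trans (Nat.le_mul_of_pos_right _ (F.P 0).L_pos) hfl
      have h := Sect2.cover_image_Ω_cubeIdxP'_subset_of_within_mem_box (P := F.P K) hM₁ sq hsep hfloor hj2 hjk hx hy hxy 0
      rwa [cubeIdxP'_Ω] at h
  -- ### (a) `InAk` for the DENTED family: the constant family's, by antitonicity
  have hηpos : 0 < (F.P K).eta j := B3GkZeroTorusRescaled.eta_pos (F.P K) j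
  have hInAk : InAk (F.P K).L j ((F.P K).eta j) (((F.P K).L : ℝ) ^ 3 * ε (j - 1)) (dentFamZ (F.P K) j Mc ρ idx ((domainsOfSeq sq.Ω j hk).Om j)) (fun x μ => ιSU N (U ⟨cover (F.P K) (x + fun _ => (ctrShift (F.P K).L j : ℤ)), μ⟩)) :=
    inAk_dentFamZ_of_tcubeZ
      (inAk_coverLiftShift_tcubeZ_of_top N U hP hD (cornerP (F.P K) Mc ρ idx) (sideP (F.P K) Mc ρ) ρ j hηpos (fun _ => j - 1) (fun _ _ => by omega)
        (fun _ _ => hcollar) (fun j' hj' => (tol_of_level_pred (F.P K) hj1 hεj1.le hj').1) (fun j' hj' => (tol_of_level_pred (F.P K) hj1 hεj1.le hj').2))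
  -- ### the dent premise from the (c-ii)‴ grid row (✓p753327)
  have hdent := dentFamZ_top_superblockSaturated_seqOfRecord F ν M g K k sq hk hj1 hjk (e := s) (hgrid j hj1 hjk) Mc ρ hsρ idx
  -- ### the pre-composed crown at the dented datum
  obtain ⟨u₀, hu₀, hoff₀, h129, hLanW, hrows, hsuW, hagree, hmsup, hbn1, hbn2, -⟩ :=
    hcrown K U j hj1 hk idx ((domainsOfSeq sq.Ω j hk).Om j) hdent _ hαpos hαle hInAk h hSU X hconst ω hω0 hω1 hoscj hosc0
  -- ### the explicit-`u` precomp door at `um := h⁻¹·u₀`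
  have humSU : ∀ x, (h⁻¹ * u₀) x ∈ specialUnitaryUnits (Fin N) := fun x => by
    rw [Pi.mul_apply, Pi.inv_apply]; exact Subgroup.mul_mem _ (Subgroup.inv_mem _ (hSU x)) (hu₀ x)
  have humoff : ∀ x, x ∉ (recordCubePZ (F.P K) j hj1 hk Mc ρ hρ idx ((domainsOfSeq sq.Ω j hk).Om j)).sq 0 → (h⁻¹ * u₀) x = 1 := fun x hx => by
    rw [Pi.mul_apply, Pi.inv_apply, hh1 x hx, hoff₀ x hx, inv_one, one_mul]
  obtain ⟨u, A, h1, hlev, h2, h3, h4c, h4'', hA7, h5, hsid, -, -, hgradAll, -⟩ :=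
    exists_localGauge152_recTower_member_grad_precomp_explicit (P := F.P K) (N := N) hd (recordCubePZ (F.P K) j hj1 hk Mc ρ hρ idx ((domainsOfSeq sq.Ω j hk).Om j)) U (n := j) rfl hr (h⁻¹ * u₀)
      ⟨humSU, humoff, hLanW, hrows, hsuW, hagree, hmsup, hbn1, hbn2⟩ hinj h4'
  -- ### row 8 ((153)) at the MEET's own cells (MODULE 128)
  have hA0 : ∀ x, x ∈ (recordCubePZ (F.P K) j hj1 hk Mc ρ hρ idx ((domainsOfSeq sq.Ω j hk).Om j)).sq 0 → ∀ κ', A ⟨cover (F.P K) (x + fun _ => (ctrShift (F.P K).L j : ℤ)), κ'⟩ =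
      logCfg ((F.P K).eta j) ((recordCubePZ (F.P K) j hj1 hk Mc ρ hρ idx ((domainsOfSeq sq.Ω j hk).Om j)).fixed (fun x μ => ιSU N (U ⟨cover (F.P K) (x + fun _ => (ctrShift (F.P K).L j : ℤ)), μ⟩)) (h⁻¹ * u₀)) x κ' :=
    fun x hx κ' => hA7 x (CubeB8DZ.sq_zero_subset_tcube (F.P K).hL.1 (F.P K).hL.2 _ hx) κ'
  have hnest : ∀ i : ℕ, 1 ≤ i → i + 1 ≤ j - 1 → sq.Ω (i + 1) ⊆ sq.Ω i := fun i hi1 hij => sq.chain.Ω_succ_subset_Ω hi1 (by omega)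
  have hΩ : ∀ j', 1 ≤ j' → j' < j → ∀ z ∈ (recordCubePZ (F.P K) j hj1 hk Mc ρ hρ idx ((domainsOfSeq sq.Ω j hk).Om j)).lamS j',
      coverAt (F.P K) j' (z + fun _ => ((ctrShift (F.P K).L (j - j') : ℕ) : ℤ)) ∈ (domainsOfSeq sq.Ω j hk).Om j' := by
    intro j' hj'1 hj' z hz
    have hz' := hz
    simp only [CubeB8DZ.lamS, recordCubePZ_k, hj'.le, if_true, Set.mem_setOf_eq] at hz'
    have hbox : InBox (B8Eq131Cubes.sqLo (F.P K).L (cornerP (F.P K) Mc ρ idx) ρ j j') (B8Eq131Cubes.sqHi (F.P K).L (cornerP (F.P K) Mc ρ idx) (sideP (F.P K) Mc ρ) ρ j j')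
        (z + fun _ => ((ctrShift (F.P K).L (j - j') : ℕ) : ℤ)) := by
      have hb := hz'.1
      rw [show (recordCubePZ (F.P K) j hj1 hk Mc ρ hρ idx ((domainsOfSeq sq.Ω j hk).Om j)).a = cornerP (F.P K) Mc ρ idx from rfl, show (recordCubePZ (F.P K) j hj1 hk Mc ρ hρ idx ((domainsOfSeq sq.Ω j hk).Om j)).ρ = ρ from rfl, show (recordCubePZ (F.P K) j hj1 hk Mc ρ hρ idx ((domainsOfSeq sq.Ω j hk).Om j)).M = sideP (F.P K) Mc ρ from rfl,
        B8Eq131CubesRecDictionary.inBox_sqZ_iff_add_ctrShift] at hb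
      exact hb
    have hcollar' : cover (F.P K) '' tcube (F.P K).L (cornerP (F.P K) Mc ρ idx) (sideP (F.P K) Mc ρ) ρ j ⊆ sq.Ω (j - 1) := by
      have hj2 : j - 1 ≠ 0 := by omega
      rw [if_neg hj2] at hcollar; exact hcollar
    exact mem_domainsOfSeq_Om_of_cover_tcube_subset F K sq.Ω hk hnest hρ1 hcollar' hj'1 hj' hbox
  have hRE := fun φ => RE_dsE_re_im_eq_zero_meet_of_isLandau138Z_recordCubePZ hj1 hk hρ idx (domainsOfSeq sq.Ω j hk) hinj0 hA0 h5 hΩ φ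
  -- ### the strict budgets (`t ≤ L⁴`)
  have hLK : (1 : ℝ) ≤ ((F.P K).L : ℝ) := by rw [T4Family.P_L]; exact hL1
  have hL0 : (0 : ℝ) ≤ ((F.P K).L : ℝ) := by linarith
  have hrow : ∀ t : ℝ, 0 ≤ t → t ≤ ((F.P K).L : ℝ) ^ 4 → 2 * (r * t) < κ * ε j := by
    intro t ht htL
    rw [hrF]; rw [T4Family.P_L] at htL; exact hbud t ht htL
  have hLpow : ∀ i : ℕ, i ≤ 4 → ((F.P K).L : ℝ) ^ i ≤ ((F.P K).L : ℝ) ^ 4 := fun i hi => pow_le_pow_right₀ hLK hi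
  -- ### the level letters on `□_{j′}ᶻ` for EVERY `j′ ≤ j`, the top read one level down
  have hsqZ : ∀ j', j' < j → (recordCubePZ (F.P K) j hj1 hk Mc ρ hρ idx ((domainsOfSeq sq.Ω j hk).Om j)).sq j' = cubeZ (F.P K).L (cornerP (F.P K) Mc ρ idx) (sideP (F.P K) Mc ρ) ρ j j' := fun j' hj' => by
    rw [recordCubePZ_sq_of_lt j hj1 hk Mc ρ hρ idx _ hj', propCubePZ_sq_eq_cubeZ (P := F.P K) j hj1 Mc ρ hρ idx hj'.le]
  have hdown : ∀ j', j' ≤ j → ∃ i, i ≤ j ∧ i < j ∧ i ≤ j' ∧ j' ≤ i + 1 ∧ (j' < j → i = j') := fun j' hj' => by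
    rcases Nat.lt_or_ge j' j with hlt | hge
    · exact ⟨j', hj', hlt, le_rfl, Nat.le_succ _, fun _ => rfl⟩
    · exact ⟨j - 1, by omega, by omega, by omega, by omega, fun h => absurd h (by omega)⟩
  have hlevZ : ∀ j', j' ≤ j → ∀ (xx : Pt (F.P K).d) (μ : Fin (F.P K).d),
      xx ∈ cubeZ (F.P K).L (cornerP (F.P K) Mc ρ idx) (sideP (F.P K) Mc ρ) ρ j j' → xx + e μ ∈ cubeZ (F.P K).L (cornerP (F.P K) Mc ρ idx) (sideP (F.P K) Mc ρ) ρ j j' →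
      ‖A ⟨cover (F.P K) (xx + fun _ => (ctrShift (F.P K).L j : ℤ)), μ⟩‖ ≤ 2 * (r * (((F.P K).L : ℝ) * (((F.P K).L : ℝ) ^ j' * (F.P K).eta j)⁻¹)) := by
    intro j' hj' xx μ hxx hxx'
    obtain ⟨i, hij, hilt, hij', hj'i, -⟩ := hdown j' hj'
    have hsub : cubeZ (F.P K).L (cornerP (F.P K) Mc ρ idx) (sideP (F.P K) Mc ρ) ρ j j' ⊆ (recordCubePZ (F.P K) j hj1 hk Mc ρ hρ idx ((domainsOfSeq sq.Ω j hk).Om j)).sq i := by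
      rw [hsqZ i hilt]; exact B8Eq131CubesRec.cube_anti (F.P K).hL.1 hij' hj'
    have hb := hlev i hij xx μ (hsub hxx) (hsub hxx')
    refine hb.trans ?_
    -- `(L^i η)⁻¹ ≤ L·(L^{j′} η)⁻¹` for `j′ ≤ i + 1`
    have hLi : (0 : ℝ) < ((F.P K).L : ℝ) ^ i := by positivity
    have hkey : (((F.P K).L : ℝ) ^ i * (F.P K).eta j)⁻¹ ≤ ((F.P K).L : ℝ) * (((F.P K).L : ℝ) ^ j' * (F.P K).eta j)⁻¹ := by
      rw [mul_inv, mul_inv, ← mul_assoc]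
      refine mul_le_mul_of_nonneg_right ?_ (inv_nonneg.2 hηpos.le)
      rw [inv_le_iff_one_le_mul₀ hLi]
      have : (1 : ℝ) ≤ ((F.P K).L : ℝ) * (((F.P K).L : ℝ) ^ j')⁻¹ * ((F.P K).L : ℝ) ^ i := by
        have hpow : ((F.P K).L : ℝ) ^ j' ≤ ((F.P K).L : ℝ) ^ (i + 1) := pow_le_pow_right₀ hLK hj'i
        have hLj : (0 : ℝ) < ((F.P K).L : ℝ) ^ j' := by positivity
        calc (1 : ℝ) = ((F.P K).L : ℝ) ^ j' * (((F.P K).L : ℝ) ^ j')⁻¹ := by rw [mul_inv_cancel₀ hLj.ne']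
          _ ≤ ((F.P K).L : ℝ) ^ (i + 1) * (((F.P K).L : ℝ) ^ j')⁻¹ := mul_le_mul_of_nonneg_right hpow (inv_nonneg.2 hLj.le)
          _ = ((F.P K).L : ℝ) * (((F.P K).L : ℝ) ^ j')⁻¹ * ((F.P K).L : ℝ) ^ i := by ring
      exact this
    exact mul_le_mul_of_nonneg_left (mul_le_mul_of_nonneg_left hkey hr) (by norm_num)
  have hgradZ : ∀ j', j' ≤ j → ∀ (xx : Pt (F.P K).d) (μ ν' : Fin (F.P K).d),
      xx ∈ cubeZ (F.P K).L (cornerP (F.P K) Mc ρ idx) (sideP (F.P K) Mc ρ) ρ j j' → xx + e μ ∈ cubeZ (F.P K).L (cornerP (F.P K) Mc ρ idx) (sideP (F.P K) Mc ρ) ρ j j' →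
      ‖logCfg ((F.P K).eta j) ((recordCubePZ (F.P K) j hj1 hk Mc ρ hρ idx ((domainsOfSeq sq.Ω j hk).Om j)).fixed (fun x μ => ιSU N (U ⟨cover (F.P K) (x + fun _ => (ctrShift (F.P K).L j : ℤ)), μ⟩)) (h⁻¹ * u₀)) (xx + e μ) ν' - logCfg ((F.P K).eta j) ((recordCubePZ (F.P K) j hj1 hk Mc ρ hρ idx ((domainsOfSeq sq.Ω j hk).Om j)).fixed (fun x μ => ιSU N (U ⟨cover (F.P K) (x + fun _ => (ctrShift (F.P K).L j : ℤ)), μ⟩)) (h⁻¹ * u₀)) xx ν'‖ ≤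
        (F.P K).eta j * (2 * ((F.P K).eta j * r * (((F.P K).L : ℝ) ^ 2 * ((((F.P K).L : ℝ) ^ j' * (F.P K).eta j) ^ 2)⁻¹)) * ((F.P K).eta j)⁻¹) := by
    intro j' hj' xx μ ν' hxx hxx'
    obtain ⟨i, hij, hilt, hij', hj'i, -⟩ := hdown j' hj'
    have hsub : cubeZ (F.P K).L (cornerP (F.P K) Mc ρ idx) (sideP (F.P K) Mc ρ) ρ j j' ⊆ (recordCubePZ (F.P K) j hj1 hk Mc ρ hρ idx ((domainsOfSeq sq.Ω j hk).Om j)).sq i := by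
      rw [hsqZ i hilt]; exact B8Eq131CubesRec.cube_anti (F.P K).hL.1 hij' hj'
    have hb := hgradAll i hij xx μ ν' (hsub hxx) (hsub hxx')
    refine hb.trans ?_
    have hηpos' : 0 < (F.P K).eta j := hηpos
    have hre : ∀ X : ℝ, (F.P K).eta j * (X * ((F.P K).eta j)⁻¹) = X := fun X => by field_simp
    rw [hre]
    -- `((L^i η)²)⁻¹ ≤ L²·((L^{j′} η)²)⁻¹`
    have hLi : (0 : ℝ) < (((F.P K).L : ℝ) ^ i * (F.P K).eta j) ^ 2 := by positivity
    have hLj : (0 : ℝ) < (((F.P K).L : ℝ) ^ j' * (F.P K).eta j) ^ 2 := by positivity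
    have hkey : ((((F.P K).L : ℝ) ^ i * (F.P K).eta j) ^ 2)⁻¹ ≤ ((F.P K).L : ℝ) ^ 2 * ((((F.P K).L : ℝ) ^ j' * (F.P K).eta j) ^ 2)⁻¹ := by
      rw [inv_le_iff_one_le_mul₀ hLi]
      have hpow : (((F.P K).L : ℝ) ^ j' * (F.P K).eta j) ^ 2 ≤ ((F.P K).L : ℝ) ^ 2 * (((F.P K).L : ℝ) ^ i * (F.P K).eta j) ^ 2 := by
        have h1 : ((F.P K).L : ℝ) ^ j' ≤ ((F.P K).L : ℝ) * ((F.P K).L : ℝ) ^ i := by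
          rw [← pow_succ']; exact pow_le_pow_right₀ hLK hj'i
        have h2 : ((F.P K).L : ℝ) ^ j' * (F.P K).eta j ≤ ((F.P K).L : ℝ) * ((F.P K).L : ℝ) ^ i * (F.P K).eta j :=
          mul_le_mul_of_nonneg_right h1 hηpos'.le
        have h0 : 0 ≤ ((F.P K).L : ℝ) ^ j' * (F.P K).eta j := by positivity
        calc (((F.P K).L : ℝ) ^ j' * (F.P K).eta j) ^ 2 ≤ (((F.P K).L : ℝ) * ((F.P K).L : ℝ) ^ i * (F.P K).eta j) ^ 2 := pow_le_pow_left₀ h0 h2 2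
          _ = ((F.P K).L : ℝ) ^ 2 * (((F.P K).L : ℝ) ^ i * (F.P K).eta j) ^ 2 := by ring
      calc (1 : ℝ) = (((F.P K).L : ℝ) ^ j' * (F.P K).eta j) ^ 2 * ((((F.P K).L : ℝ) ^ j' * (F.P K).eta j) ^ 2)⁻¹ := by rw [mul_inv_cancel₀ hLj.ne']
        _ ≤ ((F.P K).L : ℝ) ^ 2 * (((F.P K).L : ℝ) ^ i * (F.P K).eta j) ^ 2 * ((((F.P K).L : ℝ) ^ j' * (F.P K).eta j) ^ 2)⁻¹ :=
            mul_le_mul_of_nonneg_right hpow (inv_nonneg.2 hLj.le)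
        _ = ((F.P K).L : ℝ) ^ 2 * ((((F.P K).L : ℝ) ^ j' * (F.P K).eta j) ^ 2)⁻¹ * (((F.P K).L : ℝ) ^ i * (F.P K).eta j) ^ 2 := by ring
    have h0 : 0 ≤ (F.P K).eta j * r := by positivity
    exact mul_le_mul_of_nonneg_left (mul_le_mul_of_nonneg_left hkey h0) (by norm_num)
  -- ### assemble
  refine ⟨hcollar, u₀, hu₀, hoff₀, h129, u, A, hsid, ?_, h1, ?_, ?_, ?_, ?_, ?_, ?_, hRE⟩
  · -- row 1: the box lies in `□₀`
    intro b hb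
    exact h1 b (Sect2.regionOfSet_bonds_mono (Set.image_mono (B8Eq131Cubes.box_subset_cube (Nat.zero_le j))) hb)
  · -- row 3: torus letters from the ℤᵈ ones on `□_{j′}ᶻ`, `(L^{j′}η_j)⁻¹ = L^{j−j′}`, budget `t := L`
    intro j' hj' b hb
    have hb' := norm_le_of_mem_regionOfSet_cover_image_cube (N := N) hρ1 hinj
      (R := fun j' => 2 * (r * (((F.P K).L : ℝ) * (((F.P K).L : ℝ) ^ j' * (F.P K).eta j)⁻¹))) hlevZ hj' b hb
    refine hb'.trans_lt ?_
    show 2 * (r * (((F.P K).L : ℝ) * (((F.P K).L : ℝ) ^ j' * (F.P K).eta j)⁻¹)) < κ * ε j * ((F.P K).L : ℝ) ^ (j - j')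
    rw [pow_mul_eta_inv_eq (F.P K) hj']
    have hpos : (0 : ℝ) < ((F.P K).L : ℝ) ^ (j - j') := by positivity
    have := hrow _ hL0 (by simpa using hLpow 1 (by norm_num))
    calc 2 * (r * (((F.P K).L : ℝ) * ((F.P K).L : ℝ) ^ (j - j'))) = 2 * (r * ((F.P K).L : ℝ)) * ((F.P K).L : ℝ) ^ (j - j') := by ring
      _ < κ * ε j * ((F.P K).L : ℝ) ^ (j - j') := mul_lt_mul_of_pos_right this hpos
  · -- (T2b): derivative stencils from the ℤᵈ letters, `((L^{j′}η_j)²)⁻¹ = (L^{j−j′})²`, budget `t := L²`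
    intro j' hj' q hq
    have hq' := norm_grad_le_of_mem_regionOfSet_cover_image_cube (N := N) hρ1 hinj hηpos
      (R := fun j' => 2 * ((F.P K).eta j * r * (((F.P K).L : ℝ) ^ 2 * ((((F.P K).L : ℝ) ^ j' * (F.P K).eta j) ^ 2)⁻¹)) * ((F.P K).eta j)⁻¹)
      (fun xx hxx μ => hA0 xx (by rw [hsqZ 0 (by omega)]; exact hxx) μ) hgradZ hj' q hq
    refine hq'.trans_lt ?_
    show 2 * ((F.P K).eta j * r * (((F.P K).L : ℝ) ^ 2 * ((((F.P K).L : ℝ) ^ j' * (F.P K).eta j) ^ 2)⁻¹)) * ((F.P K).eta j)⁻¹ <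
      κ * ε j * ((F.P K).L : ℝ) ^ (2 * (j - j'))
    rw [← inv_pow, pow_mul_eta_inv_eq (F.P K) hj', pow_mul']
    have hpos : (0 : ℝ) < (((F.P K).L : ℝ) ^ (j - j')) ^ 2 := by positivity
    have := hrow _ (by positivity) (hLpow 2 (by norm_num))
    have hre : 2 * ((F.P K).eta j * r * (((F.P K).L : ℝ) ^ 2 * (((F.P K).L : ℝ) ^ (j - j')) ^ 2)) * ((F.P K).eta j)⁻¹ =
        2 * (r * ((F.P K).L : ℝ) ^ 2) * (((F.P K).L : ℝ) ^ (j - j')) ^ 2 := by field_simp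
    rw [hre]
    exact mul_lt_mul_of_pos_right this hpos
  · -- row 4 (box letter `2rL`), budget `t := L`
    intro b hb
    exact (h2 b hb).trans_lt (by
      have := hrow _ hL0 (by simpa using hLpow 1 (by norm_num))
      simpa [mul_comm, mul_left_comm, mul_assoc] using this)
  · -- row 5 (box gradient `2rL²`), budget `t := L²`
    intro q hq
    exact (h3 q hq).trans_lt (by
      have := hrow _ (by positivity) (hLpow 2 (by norm_num))
      simpa [mul_comm, mul_left_comm, mul_assoc] using this)
  · -- row 6, budget `t := L³`
    intro b hb
    exact (h4c b hb).trans_lt (by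
      have := hrow _ (by positivity) (hLpow 3 (by norm_num))
      simpa [mul_comm, mul_left_comm, mul_assoc] using this)
  · -- row 7, budget `t := L³`
    intro b hb
    exact (h4'' b hb).trans_lt (by
      have := hrow _ (by positivity) (hLpow 3 (by norm_num))
      simpa [mul_comm, mul_left_comm, mul_assoc] using this)

end Summit.QuantumFields.YangMills.BalabanUVNodes.N07Thm4Rows152OfDatumCrownPhiAt

end
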